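import Mathlib
import HarnessLib

/-!
# Crux `PercNearOneGluing.NearOneGluing` (stmt-CriticalPhenomena-4574), line
# `live-seal-vanishing-sprinkle` — stub `stub_fewWeakFingers`, elementary inequalities

Helper file (pure real analysis / finite combinatorics, no probability) for the stub
`stub_fewWeakFingers` of the line skeleton (lead prover-line-stmt-CriticalPhenomena-4574-a1-0),
proved in the companion file `…FewWeakFingers.lean`. Lands with `--supports stmt-CriticalPhenomena-4574`.

## Contents

* `fewWeakFingers_esymm_le_pow`: the elementary symmetric bound `e_j(W) ≤ (Σ_W y)^j` for `y ≥ 0`,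
  and its truncated-powerset form `fewWeakFingers_sum_powerset_le`:
  `Σ_{E₀ ⊆ W, 1 ≤ |E₀| ≤ m} ∏_{E₀} y ≤ Σ_{j=1}^{m} (Σ_W y)^j`;
* `fewWeakFingers_sum_Icc_pow_le`: `Σ_{j=1}^{m} x^j ≤ m (x + x^m)` (`x ≥ 0`);
* `fewWeakFingers_exp_mul_pow_le`: `u ↦ e^{-u} u^j` is non-increasing on `[j, ∞)` (no calculus:
  `(u/v)^j ≤ e^{j(u-v)/v} ≤ e^{u-v}`), whence the two-regime bound `fewWeakFingers_f_le`:
  `κ (-2 log κ)^j ≤ (κ + η) (4 log(1/η))^j` for `0 ≤ κ ≤ 1`, `1 ≤ j ≤ 2 log(1/η)`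
  (split at `κ = η²`);
* `fewWeakFingers_prod_ite_le`: for weak indices (`q_a ≥ 1/2` on `E₀ ⊆ A`)
  `∏_{a ∈ A} (a ∈ E₀ ? 1 - q_a : q_a) ≤ (∏_A q_a) · ∏_{E₀} 2(1 - q_a)`;
* `fewWeakFingers_class_sum_le`: the per-class analytic estimate
  `κ_A · Σ_{E₀ ⊆ W, 1 ≤ |E₀| ≤ m} ∏_{E₀} 2(1 - q_a) ≤ m (f_1(κ_A) + f_m(κ_A))`,
  `f_j(κ) = κ (-2 log κ)^j`, using `1 - q ≤ -log q`;
* `fewWeakFingersAux`: the registered auxiliary sub-goal (= the elementary symmetric bound).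
-/

namespace Summit.CriticalPhenomena.PercolationContinuityZ3.Theorems

open scoped BigOperators

section FewWeakFingersElementary

variable {ι : Type*}

/-- **Elementary symmetric bound.** For `y ≥ 0` on `W`: `Σ_{E₀ ⊆ W, |E₀| = j} ∏_{a ∈ E₀} y a ≤ (Σ_{a ∈ W} y a)^j`
(induction on `W` via `e_{j+1}(W ∪ {b}) = e_{j+1}(W) + y_b e_j(W)` and
`Y^{j+1} + y_b Y^j ≤ (Y + y_b)^{j+1}`). -/
theorem fewWeakFingers_esymm_le_pow (y : ι → ℝ) (W : Finset ι) (hy : ∀ a ∈ W, 0 ≤ y a) (j : ℕ) :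
    ∑ E₀ ∈ W.powersetCard j, ∏ a ∈ E₀, y a ≤ (∑ a ∈ W, y a) ^ j := by
  classical
  induction W using Finset.induction_on generalizing j with
  | empty =>
    cases j with
    | zero => simp [Finset.powersetCard_zero]
    | succ j =>
      have h : (∅ : Finset ι).powersetCard (j + 1) = ∅ :=
        Finset.powersetCard_eq_empty.2 (by simp)
      simp [h]
  | insert b W hb ih =>
    have hyW : ∀ a ∈ W, 0 ≤ y a := fun a ha => hy a (Finset.mem_insert_of_mem ha)
    have hyb : 0 ≤ y b := hy b (Finset.mem_insert_self b W)
    have hY : 0 ≤ ∑ a ∈ W, y a := Finset.sum_nonneg hyW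
    cases j with
    | zero => simp [Finset.powersetCard_zero]
    | succ j =>
      rw [Finset.powersetCard_succ_insert hb, Finset.sum_union, Finset.sum_image,
        Finset.sum_insert hb]
      · have h1 : ∑ S ∈ W.powersetCard j, ∏ a ∈ insert b S, y a =
            y b * ∑ S ∈ W.powersetCard j, ∏ a ∈ S, y a := by
          rw [Finset.mul_sum]
          refine Finset.sum_congr rfl fun S hS => ?_
          have hbS : b ∉ S := fun h => hb ((Finset.mem_powersetCard.1 hS).1 h)
          rw [Finset.prod_insert hbS]
        rw [h1]
        calc ∑ S ∈ W.powersetCard (j + 1), ∏ a ∈ S, y a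
              + y b * ∑ S ∈ W.powersetCard j, ∏ a ∈ S, y a
            ≤ (∑ a ∈ W, y a) ^ (j + 1) + y b * (∑ a ∈ W, y a) ^ j :=
              add_le_add (ih hyW (j + 1)) (mul_le_mul_of_nonneg_left (ih hyW j) hyb)
          _ = (y b + ∑ a ∈ W, y a) * (∑ a ∈ W, y a) ^ j := by ring
          _ ≤ (y b + ∑ a ∈ W, y a) * (y b + ∑ a ∈ W, y a) ^ j :=
              mul_le_mul_of_nonneg_left (pow_le_pow_left₀ hY (by linarith) j) (by linarith)
          _ = (y b + ∑ a ∈ W, y a) ^ (j + 1) := by ring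
      · intro S hS S' hS' hSS'
        have hbS : b ∉ S := fun h =>
          hb ((Finset.mem_powersetCard.1 (Finset.mem_coe.1 hS)).1 h)
        have hbS' : b ∉ S' := fun h =>
          hb ((Finset.mem_powersetCard.1 (Finset.mem_coe.1 hS')).1 h)
        rw [← Finset.erase_insert hbS, hSS', Finset.erase_insert hbS']
      · rw [Finset.disjoint_left]
        intro S hS hS'
        obtain ⟨S', -, rfl⟩ := Finset.mem_image.1 hS'
        exact hb ((Finset.mem_powersetCard.1 hS).1 (Finset.mem_insert_self b S'))

/-- **Truncated powerset sum.** For `y ≥ 0` on `W`: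
`Σ_{E₀ ⊆ W, 1 ≤ |E₀| ≤ m} ∏_{a ∈ E₀} y a ≤ Σ_{j = 1}^{m} (Σ_{a ∈ W} y a)^j`. -/
theorem fewWeakFingers_sum_powerset_le (y : ι → ℝ) (W : Finset ι) (hy : ∀ a ∈ W, 0 ≤ y a)
    (m : ℕ) :
    ∑ E₀ ∈ W.powerset.filter (fun E₀ => 1 ≤ E₀.card ∧ E₀.card ≤ m), ∏ a ∈ E₀, y a ≤
      ∑ j ∈ Finset.Icc 1 m, (∑ a ∈ W, y a) ^ j := by
  classical
  have hdecomp : W.powerset.filter (fun E₀ => 1 ≤ E₀.card ∧ E₀.card ≤ m) =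
      (Finset.Icc 1 m).biUnion (fun j => W.powersetCard j) := by
    ext E₀
    simp only [Finset.mem_filter, Finset.mem_powerset, Finset.mem_biUnion, Finset.mem_Icc,
      Finset.mem_powersetCard]
    constructor
    · rintro ⟨h1, h2, h3⟩
      exact ⟨E₀.card, ⟨h2, h3⟩, h1, rfl⟩
    · rintro ⟨j, ⟨h2, h3⟩, h1, rfl⟩
      exact ⟨h1, h2, h3⟩
  rw [hdecomp, Finset.sum_biUnion]
  · exact Finset.sum_le_sum fun j _ => fewWeakFingers_esymm_le_pow y W hy j
  · intro j _ j' _ hjj'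
    simp only [Function.onFun]
    rw [Finset.disjoint_left]
    intro S hS hS'
    exact hjj' ((Finset.mem_powersetCard.1 hS).2.symm.trans (Finset.mem_powersetCard.1 hS').2)

/-- `x^j ≤ x + x^m` for `x ≥ 0` and `1 ≤ j ≤ m`. -/
theorem fewWeakFingers_pow_le_add_pow {x : ℝ} (hx : 0 ≤ x) {j m : ℕ} (hj : 1 ≤ j) (hjm : j ≤ m) :
    x ^ j ≤ x + x ^ m := by
  rcases le_total x 1 with h | h
  · calc x ^ j ≤ x ^ 1 := pow_le_pow_of_le_one hx h hj
      _ = x := pow_one x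
      _ ≤ x + x ^ m := le_add_of_nonneg_right (pow_nonneg hx m)
  · calc x ^ j ≤ x ^ m := pow_le_pow_right₀ h hjm
      _ ≤ x + x ^ m := le_add_of_nonneg_left hx

/-- `Σ_{j = 1}^{m} x^j ≤ m (x + x^m)` for `x ≥ 0`. -/
theorem fewWeakFingers_sum_Icc_pow_le {x : ℝ} (hx : 0 ≤ x) (m : ℕ) :
    ∑ j ∈ Finset.Icc 1 m, x ^ j ≤ m * (x + x ^ m) := by
  have h := Finset.sum_le_card_nsmul (Finset.Icc 1 m) (fun j => x ^ j) (x + x ^ m)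
    (fun j hj => fewWeakFingers_pow_le_add_pow hx (Finset.mem_Icc.1 hj).1 (Finset.mem_Icc.1 hj).2)
  rw [Nat.card_Icc, nsmul_eq_mul] at h
  simpa using h

/-- **Monotonicity without calculus.** For `0 < v ≤ u` and `j ≤ v`:
`e^{-u} u^j ≤ e^{-v} v^j` (since `(u/v)^j ≤ e^{j (u-v)/v} ≤ e^{u-v}`). -/
theorem fewWeakFingers_exp_mul_pow_le {j : ℕ} {u v : ℝ} (hv : 0 < v) (hjv : (j : ℝ) ≤ v)
    (hvu : v ≤ u) : Real.exp (-u) * u ^ j ≤ Real.exp (-v) * v ^ j := by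
  have hu : 0 < u := lt_of_lt_of_le hv hvu
  have h1 : u / v ≤ Real.exp ((u - v) / v) := by
    have : u / v = (u - v) / v + 1 := by
      field_simp
      ring
    rw [this]
    exact Real.add_one_le_exp _
  have h2 : (u / v) ^ j ≤ Real.exp (u - v) := by
    calc (u / v) ^ j ≤ Real.exp ((u - v) / v) ^ j :=
          pow_le_pow_left₀ (div_nonneg hu.le hv.le) h1 j
      _ = Real.exp (j * ((u - v) / v)) := by rw [← Real.exp_nat_mul]
      _ ≤ Real.exp (u - v) := by
          rw [Real.exp_le_exp]
          have hj1 : (j : ℝ) / v ≤ 1 := (div_le_one hv).2 hjv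
          have : (j : ℝ) * ((u - v) / v) = (j / v) * (u - v) := by ring
          rw [this]
          nlinarith [sub_nonneg.2 hvu]
  have h3 : u ^ j = v ^ j * (u / v) ^ j := by
    rw [← mul_pow]
    congr 1
    field_simp
  calc Real.exp (-u) * u ^ j = Real.exp (-u) * (v ^ j * (u / v) ^ j) := by rw [h3]
    _ ≤ Real.exp (-u) * (v ^ j * Real.exp (u - v)) :=
        mul_le_mul_of_nonneg_left (mul_le_mul_of_nonneg_left h2 (pow_nonneg hv.le j))
          (Real.exp_pos _).le
    _ = Real.exp (-v) * v ^ j := by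
        have : Real.exp (-v) = Real.exp (-u) * Real.exp (u - v) := by
          rw [← Real.exp_add]; ring_nf
        rw [this]; ring

/-- **Two-regime bound for `f_j(κ) = κ (-2 log κ)^j`.** For `0 ≤ κ ≤ 1`, `0 < η ≤ 1` and
`1 ≤ j ≤ 2 log(1/η)`: `κ (-2 log κ)^j ≤ (κ + η) (4 log(1/η))^j`.  (For `κ ≥ η²`,
`-log κ ≤ 2 log(1/η)`; for `κ < η²`, `f_j` is non-decreasing on `(0, e^{-j}] ∋ η²` and
`f_j(η²) = η² (4 log(1/η))^j ≤ η (4 log(1/η))^j`.) -/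
theorem fewWeakFingers_f_le {κ η : ℝ} (hκ0 : 0 ≤ κ) (hκ1 : κ ≤ 1) (hη0 : 0 < η) (hη1 : η ≤ 1)
    {j : ℕ} (hj : 1 ≤ j) (hjL : (j : ℝ) ≤ 2 * (-Real.log η)) :
    κ * (-2 * Real.log κ) ^ j ≤ (κ + η) * (4 * (-Real.log η)) ^ j := by
  have hL0 : 0 ≤ -Real.log η := neg_nonneg.2 (Real.log_nonpos hη0.le hη1)
  have h4L : 0 ≤ (4 * (-Real.log η)) ^ j := pow_nonneg (by linarith) j
  rcases hκ0.eq_or_lt with h0 | hκpos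
  · rw [← h0, zero_mul, zero_add]
    exact mul_nonneg hη0.le h4L
  have hlogη2 : Real.log (η ^ 2) = 2 * Real.log η := by
    rw [Real.log_pow]; push_cast; ring
  rcases le_or_gt (η ^ 2) κ with hge | hlt
  · have h1 : -Real.log κ ≤ 2 * (-Real.log η) := by
      have := Real.log_le_log (pow_pos hη0 2) hge
      rw [hlogη2] at this
      linarith
    have h2 : 0 ≤ -Real.log κ := neg_nonneg.2 (Real.log_nonpos hκ0 hκ1)
    calc κ * (-2 * Real.log κ) ^ j ≤ κ * (4 * (-Real.log η)) ^ j :=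
          mul_le_mul_of_nonneg_left (pow_le_pow_left₀ (by linarith) (by linarith) j) hκ0
      _ ≤ (κ + η) * (4 * (-Real.log η)) ^ j := mul_le_mul_of_nonneg_right (by linarith) h4L
  · have hvpos : 0 < -Real.log (η ^ 2) := by
      rw [hlogη2]
      have : (1 : ℝ) ≤ j := by exact_mod_cast hj
      linarith
    have hvu : -Real.log (η ^ 2) ≤ -Real.log κ := neg_le_neg (Real.log_le_log hκpos hlt.le)
    have hjv : (j : ℝ) ≤ -Real.log (η ^ 2) := by rw [hlogη2]; linarith
    have key := fewWeakFingers_exp_mul_pow_le hvpos hjv hvu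
    rw [neg_neg, neg_neg, Real.exp_log hκpos, Real.exp_log (pow_pos hη0 2), hlogη2] at key
    -- key : κ * (-log κ)^j ≤ η^2 * (-(2 log η))^j
    have hη2 : η ^ 2 ≤ η := by nlinarith
    calc κ * (-2 * Real.log κ) ^ j = 2 ^ j * (κ * (-Real.log κ) ^ j) := by
          rw [show -2 * Real.log κ = 2 * (-Real.log κ) by ring, mul_pow]; ring
      _ ≤ 2 ^ j * (η ^ 2 * (-(2 * Real.log η)) ^ j) :=
          mul_le_mul_of_nonneg_left key (pow_nonneg (by norm_num) j)
      _ = η ^ 2 * (4 * (-Real.log η)) ^ j := by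
          rw [show (4 * (-Real.log η)) = 2 * (-(2 * Real.log η)) by ring, mul_pow]; ring
      _ ≤ η * (4 * (-Real.log η)) ^ j := mul_le_mul_of_nonneg_right hη2 h4L
      _ ≤ (κ + η) * (4 * (-Real.log η)) ^ j := mul_le_mul_of_nonneg_right (by linarith) h4L

/-- **Weak indices cost at most a factor two each.** If `E₀ ⊆ A`, `0 ≤ q ≤ 1` on `A` and
`q ≥ 1/2` on `E₀`, then `∏_{a ∈ A} (a ∈ E₀ ? 1 - q a : q a) ≤ (∏_{a ∈ A} q a) ∏_{a ∈ E₀} 2 (1 - q a)`. -/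
theorem fewWeakFingers_prod_ite_le [DecidableEq ι] (q : ι → ℝ) (A E₀ : Finset ι) (hEA : E₀ ⊆ A)
    (hq0 : ∀ a ∈ A, 0 ≤ q a) (hq1 : ∀ a ∈ A, q a ≤ 1) (hweak : ∀ a ∈ E₀, 1 / 2 ≤ q a) :
    ∏ a ∈ A, (if a ∈ E₀ then 1 - q a else q a) ≤
      (∏ a ∈ A, q a) * ∏ a ∈ E₀, 2 * (1 - q a) := by
  have h : ∏ a ∈ A, (q a * if a ∈ E₀ then 2 * (1 - q a) else 1) =
      (∏ a ∈ A, q a) * ∏ a ∈ E₀, 2 * (1 - q a) := by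
    rw [Finset.prod_mul_distrib, Finset.prod_ite_mem, Finset.inter_eq_right.2 hEA]
  rw [← h]
  refine Finset.prod_le_prod (fun a ha => ?_) (fun a ha => ?_)
  · split_ifs
    · linarith [hq1 a ha]
    · exact hq0 a ha
  · split_ifs with haE
    · nlinarith [hweak a haE, hq1 a ha]
    · rw [mul_one]

/-- `Σ_{a ∈ W} (1 - q a) ≤ -log ∏_{a ∈ A} q a` for `W ⊆ A` and `0 < q ≤ 1` on `A`
(`1 - q ≤ -log q`). -/
theorem fewWeakFingers_sum_one_sub_le_neg_log (q : ι → ℝ) (A W : Finset ι) (hWA : W ⊆ A)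
    (hq0 : ∀ a ∈ A, 0 < q a) (hq1 : ∀ a ∈ A, q a ≤ 1) :
    ∑ a ∈ W, (1 - q a) ≤ -Real.log (∏ a ∈ A, q a) := by
  rw [Real.log_prod (fun a ha => (hq0 a ha).ne'), ← Finset.sum_neg_distrib]
  calc ∑ a ∈ W, (1 - q a) ≤ ∑ a ∈ A, (1 - q a) :=
        Finset.sum_le_sum_of_subset_of_nonneg hWA fun a ha _ => sub_nonneg.2 (hq1 a ha)
    _ ≤ ∑ a ∈ A, -Real.log (q a) :=
        Finset.sum_le_sum fun a ha => by linarith [Real.log_le_sub_one_of_pos (hq0 a ha)]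

/-- **Per-class analytic estimate.** With `κ = ∏_{a ∈ A} q a` (`0 ≤ q ≤ 1` on `A`), `W ⊆ A`:
`κ · Σ_{E₀ ⊆ W, 1 ≤ |E₀| ≤ m} ∏_{a ∈ E₀} 2 (1 - q a) ≤ m (κ (-2 log κ) + κ (-2 log κ)^m)`. -/
theorem fewWeakFingers_class_sum_le (q : ι → ℝ) (A W : Finset ι) (hWA : W ⊆ A)
    (hq0 : ∀ a ∈ A, 0 ≤ q a) (hq1 : ∀ a ∈ A, q a ≤ 1) (m : ℕ) :
    (∏ a ∈ A, q a) * ∑ E₀ ∈ W.powerset.filter (fun E₀ => 1 ≤ E₀.card ∧ E₀.card ≤ m),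
        ∏ a ∈ E₀, 2 * (1 - q a) ≤
      m * ((∏ a ∈ A, q a) * (-2 * Real.log (∏ a ∈ A, q a)) +
        (∏ a ∈ A, q a) * (-2 * Real.log (∏ a ∈ A, q a)) ^ m) := by
  have hκ0 : 0 ≤ ∏ a ∈ A, q a := Finset.prod_nonneg hq0
  rcases hκ0.eq_or_lt with h0 | hpos
  · rw [← h0]
    simp
  have hqpos : ∀ a ∈ A, 0 < q a := fun a ha =>
    (hq0 a ha).lt_of_ne fun h => hpos.ne' (Finset.prod_eq_zero ha h.symm)
  have hy : ∀ a ∈ W, 0 ≤ 2 * (1 - q a) := fun a ha => by linarith [hq1 a (hWA ha)]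
  have hY : ∑ a ∈ W, 2 * (1 - q a) ≤ -2 * Real.log (∏ a ∈ A, q a) := by
    rw [← Finset.mul_sum]
    linarith [fewWeakFingers_sum_one_sub_le_neg_log q A W hWA hqpos hq1]
  have hY0 : 0 ≤ ∑ a ∈ W, 2 * (1 - q a) := Finset.sum_nonneg hy
  have hX0 : 0 ≤ -2 * Real.log (∏ a ∈ A, q a) := hY0.trans hY
  calc (∏ a ∈ A, q a) * ∑ E₀ ∈ W.powerset.filter (fun E₀ => 1 ≤ E₀.card ∧ E₀.card ≤ m),
          ∏ a ∈ E₀, 2 * (1 - q a)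
      ≤ (∏ a ∈ A, q a) * ∑ j ∈ Finset.Icc 1 m, (∑ a ∈ W, 2 * (1 - q a)) ^ j :=
        mul_le_mul_of_nonneg_left (fewWeakFingers_sum_powerset_le _ W hy m) hκ0
    _ ≤ (∏ a ∈ A, q a) * ∑ j ∈ Finset.Icc 1 m, (-2 * Real.log (∏ a ∈ A, q a)) ^ j :=
        mul_le_mul_of_nonneg_left (Finset.sum_le_sum fun j _ => pow_le_pow_left₀ hY0 hY j) hκ0
    _ ≤ (∏ a ∈ A, q a) * (m * ((-2 * Real.log (∏ a ∈ A, q a)) +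
          (-2 * Real.log (∏ a ∈ A, q a)) ^ m)) :=
        mul_le_mul_of_nonneg_left (fewWeakFingers_sum_Icc_pow_le hX0 m) hκ0
    _ = _ := by ring

end FewWeakFingersElementary

/-- **Registered auxiliary sub-goal `fewWeakFingersAux` of `stub_fewWeakFingers`** (the elementary
symmetric bound): for `y ≥ 0` on a finite set `W`,
`Σ_{E₀ ⊆ W, |E₀| = j} ∏_{a ∈ E₀} y a ≤ (Σ_{a ∈ W} y a)^j`. -/
theorem fewWeakFingersAux :
    ∀ (ι : Type) (y : ι → ℝ) (W : Finset ι) (j : ℕ), (∀ a ∈ W, 0 ≤ y a) →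
      ∑ E₀ ∈ W.powersetCard j, ∏ a ∈ E₀, y a ≤ (∑ a ∈ W, y a) ^ j :=
  fun _ y W j hy => fewWeakFingers_esymm_le_pow y W hy j

end Summit.CriticalPhenomena.PercolationContinuityZ3.Theorems
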